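import Summits.BirchSwinnertonDyer.BirchSwinnertonDyer.Theses.UniversalToricDescent
import Summits.BirchSwinnertonDyer.BirchSwinnertonDyer.Theorems.UniversalToricDescentTwinFullThreeAdicImageOverK
import Summits.BirchSwinnertonDyer.BirchSwinnertonDyer.Theorems.UniversalToricDescentTwinSplitIMCAtThreeGoodOrdIntegral
import Summits.BirchSwinnertonDyer.BirchSwinnertonDyer.Theorems.UniversalToricDescentInvariantsTransportNormProfileFrames
import Summits.BirchSwinnertonDyer.BirchSwinnertonDyer.Theorems.SchneiderFreeAdditiveX3BranchIMCHalves
import HarnessLib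

/-!
# Route `UniversalToricDescent`, RK-6 v3 item `TwinAlgMuZeroAtThree` (twin-side algebraic `μ = 0` and
# `Λ`-torsion of `X_(∅,0)(E′/K_∞^ac)` at `p = 3`) — its GOOD-ORDINARY BUCKET is a theorem modulo print

Width prover `bsd-wall-utd-p1-w2` g6 under LEAD `bsd-wall-utd-p1` g19/g20 (pen `bsd-wall-pss3x` g8 RK-6 v3,
director (362) GO). The new item reads (binders = crux #3 `TwinSplitIMCAtThree`'s prefix: a twin `W′` not
additive at `3` with `ρ̄₃` onto, `K` imaginary quadratic Heegner for `N′`, `κ` anticyclotomic, `3 = 𝔭𝔭′`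
split; NO embedding `ι′`, NO frame):
`Module.IsTorsion Λ (X_ac(W′_K) strict at 𝔭′) ∧ ∃ g′, Ch_Λ(X_ac)·R₀⟦T⟧ = (g′) ∧ ∃ i, ‖g′_i‖ = 1`.
This file proves that conclusion VERBATIM on **bucket A** — `W′` GOOD ORDINARY at `3`, `d_K` odd (the
kernel always chooses such a `K`) — in three keyings, all by name on landed theorems:

* §1 (algebra in `R₀⟦T⟧`) `exists_norm_coeff_eq_one_of_dvd` — a divisor of a series with a norm-one
  coefficient has a norm-one coefficient (`𝔪_{R₀}⟦T⟧` is an ideal: `norm_coeff_mul_lt_one_of_lt`).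
* §2 pointwise, at one instance `(W′, N′, K, Dt′, κ, γ, 𝔭, 𝔭′)`:
  - `twinAlgMu_of_goodOrd_of_yanZhu_of_muFrame` — from Yan–Zhu 2026 Thm 5.7 (1) (`h57`, the tree's
    `YanZhuMainConjectureInput`) and ONE BDP frame `L′` (at some `ι′` inducing `𝔭`) with a norm-one
    coefficient: torsion is Yan–Zhu's (re-exposed through `forall_frame_charIdeal_eq_rat_of_goodOrd`),
    the generator is `L′` itself (`Ch·R₀⟦T⟧ = (L′)` at every frame, `twinSplit_instance_of_goodOrd_of_yanZhu`,
    full `3`-adic image over `K` discharged by `ThreeAdicImageOverK`);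
  - `twinAlgMu_of_goodOrd_of_yanZhu_of_forall_mu` — the same with the analytic `μ = 0` in the `∀ ι′ ∀ frame`
    shape of the route item `TwinMuZeroAtThree` (an `ι′` exists: `SchneiderFree.exists_branchInducesPrime`;
    a frame exists: conjunct (i));
  - `twinAlgMu_of_goodOrd_of_bcs` — from BCS 2025 Thm 4.2.1 (b) (`h421`: torsion + `(L′) ⊆ Ch·R₀⟦T⟧`) and
    Prop 4.2.2 (`h422`: a frame with `μ = 0`) ALONE, no Yan–Zhu: `Ch` is principal
    (`charIdeal_isPrincipal_holds`), its generator divides the `μ = 0` frame, §1;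
  - `twinAlgMu_of_goodOrd_of_yanZhu_of_bcsMu` — Yan–Zhu + Prop 4.2.2.
* §3 the same in the ROUTE's literal currency (binder list = the item's text with `¬ Addv W′ 3` ↦
  `GoodOrd W′ 3` and `Odd (NumberField.discr K)` inserted, i.e. the prefix of the closed bucket-A child
  `TwinSplitIMCAtThreeGoodOrdOfPrint` 20693 without its `ι′` clause): from `BCSHowardDivisibilityInput ∧
  BCSMuZeroInput`, from `TwinSplitIMCAtThreePrintedFacts` (20692), from `YanZhuMainConjectureInput ∧ BCSMuZeroInput`.
* Sequel `…TwinAlgMuZeroAtThreeOfBuckets`: the route decl (item 24254) BY NAME from BCS 2025 (bucket A,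
  discharged here) ∧ bucket B (multiplicative) ∧ bucket C (good supersingular) ∧ the even-`d_K` corner.
* §4 in the KERNEL's context (a wild `W` of class O6 with its twin `W′`): from `YanZhuMainConjectureInput`
  and the route item `TwinMuZeroAtThree` (20400) BY NAME — the good-ordinary third of kernel_rat⁺'s twin
  trichotomy needs no `TwinAlgMuZeroAtThree` antecedent.

PARTITION (census TWIN-PRINT-AT3-v1 §2): bucket A = 745 of the 2 023 twin-having classes; buckets B
(multiplicative très ramifié, 675) and C₀ (good supersingular `a₃ = 0`, 603) of `TwinAlgMuZeroAtThree` are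
research at `p = 3` and untouched here. THEOREMS ONLY (no definition, no named fact, no `sorry`); conditional
on the named printed facts where they appear as hypotheses. BSD is not proved by any of this.

References: [YanZhu2024MainConjNonCM] Thm. 5.7 (1) (J. Algebra 693 (2026)); [BurungaleCastellaSkinner2025]
Thm. 4.2.1 (b), Prop. 4.2.2 (arXiv:2405.00270v2 pp. 8–9); [Washington1997] §13.2 (principal characteristic
ideals); [GreenbergVatsal2000] §1 (μ of a divisor).
-/

noncomputable section

open scoped Classical

set_option linter.dupNamespace false
set_option autoImplicit false

namespace Summit.BirchSwinnertonDyer.BirchSwinnertonDyer.Theorems.UniversalToricDescentTwinAlgMu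

open PowerSeries WeierstrassCurve NumberField IsDedekindDomain Field
  Literature.NumberTheory.EllipticCurves
  Literature.NumberTheory.EllipticCurves.ModularForms
  Literature.NumberTheory.EllipticCurves.Rank1Residual
  Literature.NumberTheory.GaloisRepresentations
  Summit.BirchSwinnertonDyer.Rank1Residual
  Summit.BirchSwinnertonDyer.Rank1Residual.X11b
  Summit.BirchSwinnertonDyer.Rank1Residual.X11b.Halves
  Summit.BirchSwinnertonDyer.BirchSwinnertonDyer.Theorems.SchneiderFree
  Summit.BirchSwinnertonDyer.BirchSwinnertonDyer.Theorems.UniversalToricDescentNormProfile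
  Summit.BirchSwinnertonDyer.BirchSwinnertonDyer.Theorems.UniversalToricDescentTwinSplit
  Summit.BirchSwinnertonDyer.BirchSwinnertonDyer.Theses.UniversalToricDescent

/-! ## §1 Algebra in `R₀⟦T⟧`: a divisor of a `μ = 0` series has `μ = 0` -/

section Algebra

variable {p : ℕ} [Fact p.Prime]

/-- **A divisor of a series with a norm-one coefficient has a norm-one coefficient** (`μ(g) ≤ μ(L)` for
`g ∣ L` in `R₀⟦T⟧`, case `μ(L) = 0`): if every coefficient of `g` had norm `< 1` then so would every
coefficient of `L = g·q` (`𝔪_{R₀}⟦T⟧` is an ideal, `norm_coeff_mul_lt_one_of_lt`). [folklore] -/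
theorem exists_norm_coeff_eq_one_of_dvd {g L : UnrSeries p} (hdvd : g ∣ L)
    (hL : ∃ k : ℕ, ‖((PowerSeries.coeff k L : unrIntegers p) : ℂ_[p])‖ = 1) :
    ∃ i : ℕ, ‖((PowerSeries.coeff i g : unrIntegers p) : ℂ_[p])‖ = 1 := by
  obtain ⟨k, hk⟩ := hL
  by_contra hne
  have hlt : ∀ i, ‖((PowerSeries.coeff i g : unrIntegers p) : ℂ_[p])‖ < 1 :=
    fun i ↦ lt_of_le_of_ne (norm_coeff_le_one g i) (fun h ↦ hne ⟨i, h⟩)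
  obtain ⟨q, rfl⟩ := hdvd
  have h := norm_coeff_mul_lt_one_of_lt q (n := k + 1) (fun i _ ↦ hlt i) k (Nat.lt_succ_self k)
  rw [mul_comm] at h
  exact absurd hk (ne_of_lt h)

/-- A unit coefficient of `R₀` has norm `1` in `ℂ_p` (`unrIntegers.isUnit_iff_norm_eq_one`), in the
`∃`-form used by the route items. [folklore] -/
theorem exists_norm_coeff_eq_one_of_exists_isUnit {L : UnrSeries p}
    (hL : ∃ k : ℕ, IsUnit (PowerSeries.coeff k L)) :
    ∃ k : ℕ, ‖((PowerSeries.coeff k L : unrIntegers p) : ℂ_[p])‖ = 1 := by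
  obtain ⟨k, hk⟩ := hL
  exact ⟨k, (unrIntegers.isUnit_iff_norm_eq_one _).mp hk⟩

/-- The image of a principal ideal under a ring map is principal, generated by the image of the
generator. [folklore] -/
theorem map_span_singleton_eq {R S : Type*} [CommRing R] [CommRing S] (φ : R →+* S) (F : R) :
    (Ideal.span {F}).map φ = Ideal.span {φ F} := by
  rw [Ideal.map_span, Set.image_singleton]

end Algebra

/-! ## §2 Bucket A of `TwinAlgMuZeroAtThree`, pointwise -/

section Pointwise

/-- **Bucket A of `TwinAlgMuZeroAtThree` from Yan–Zhu 2026 Thm 5.7 (1) and ONE `μ = 0` frame.** For a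
twin `W′` GOOD ORDINARY at `3` with `ρ̄_{W′,3}` onto over `ℚ`, `K` imaginary quadratic with the Heegner
hypothesis for `N′` and `d_K` odd, `κ` anticyclotomic, `3 = 𝔭𝔭′` split (`𝔭` of degree one, `𝔭′ ≠ 𝔭`): if
SOME BDP frame `L′` of `f_{W′}` at some `ι′` inducing `𝔭` has a coefficient of norm `1`, then `X_ac(W′_K)`
strict at `𝔭′` is `Λ`-torsion and `Ch_Λ(X_ac)·R₀⟦T⟧ = (g′)` for a `g′` with a norm-one coefficient — namely
`g′ = L′` (`twinSplit_instance_of_goodOrd_of_yanZhu` (ii); torsion from the same fact,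
`forall_frame_charIdeal_eq_rat_of_goodOrd`). CONDITIONAL on the named fact `h57`.
[cite: YanZhu2024MainConjNonCM, Thm. 5.7 (1) (§5.2; J. Algebra 693 (2026))] -/
theorem twinAlgMu_of_goodOrd_of_yanZhu_of_muFrame
    (h57 : YanZhu2026.thm57_isTorsion_charIdealXGr_eq_bdpLFunction)
    (W' : WeierstrassCurve ℚ) [W'.IsElliptic] [W'.IsGloballyMinimal] (N' : ℕ) [NeZero N']
    (K : Type) [Field K] [NumberField K] (Dt' : ModularParametrizationData W' N')
    (hord : GoodOrd W' 3) (hsurj : W'.HasSurjectiveModNGaloisRep 3)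
    (hK : IsImaginaryQuadratic K) (hH : SatisfiesHeegnerHypothesis N' K)
    (hodd : Odd (NumberField.discr K))
    (κ : ZpExtension K 3) (hκ : κ.IsAnticyclotomic) (γ : absoluteGaloisGroup K)
    [Fact (κ.IsTopGenerator γ)]
    (𝔭 : HeightOneSpectrum (𝓞 K)) (h𝔭 : ((3 : ℕ) : 𝓞 K) ∈ 𝔭.asIdeal)
    (he : 𝔭.asIdeal.ramificationIdx (𝓞 ℚ) = 1) (hf : 𝔭.asIdeal.inertiaDeg (𝓞 ℚ) = 1)
    (𝔭' : HeightOneSpectrum (𝓞 K)) (h𝔭' : ((3 : ℕ) : 𝓞 K) ∈ 𝔭'.asIdeal) (hne : 𝔭' ≠ 𝔭)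
    (hμ : ∃ ι' : PadicAlgCl 3 ≃+* ℂ, BranchInducesPrime 3 ι' 𝔭 ∧
      ∃ (ΩK : ℂ) (Ωp : ℂ_[3]) (L' : UnrSeries 3), ΩK ≠ 0 ∧ Ωp ≠ 0 ∧
        IsBDPLFunction ι' 𝔭 κ γ Dt'.f ΩK Ωp L' ∧
        ∃ i : ℕ, ‖((PowerSeries.coeff i L' : unrIntegers 3) : ℂ_[3])‖ = 1) :
    Module.IsTorsion (IwasawaAlgebra 3) (AcSelmer.XAc (W'.baseChange K) 3 κ 𝔭' ∅ γ) ∧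
      ∃ g' : UnrSeries 3,
        (AcSelmer.XAc.charIdeal (W'.baseChange K) 3 κ 𝔭' ∅ γ).map (PowerSeries.map (toUnr 3)) =
          Ideal.span {g'} ∧
        ∃ i : ℕ, ‖((PowerSeries.coeff i g' : unrIntegers 3) : ℂ_[3])‖ = 1 := by
  obtain ⟨ι', hι', ΩK, Ωp, L', hΩK, hΩp, hL', i, hi⟩ := hμ
  have htors := (forall_frame_charIdeal_eq_rat_of_goodOrd h57 W' N' K Dt' hord hsurj hK hH hodd κ hκ γ
    𝔭 h𝔭 he hf 𝔭' h𝔭' hne ι' hι').1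
  have heq := (ThreeAdicImageOverK.twinSplit_instance_of_goodOrd_of_yanZhu h57 W' N' K Dt' hord hsurj
    hK hH hodd κ hκ γ 𝔭 h𝔭 he hf 𝔭' h𝔭' hne ι' hι').2 ΩK Ωp L' hΩK hΩp hL'
  exact ⟨htors, L', heq, i, hi⟩

/-- **Bucket A of `TwinAlgMuZeroAtThree` from Yan–Zhu 2026 Thm 5.7 (1) and the analytic `μ = 0` in the
`∀`-shape of the route item `TwinMuZeroAtThree`** (every frame at every `ι′` inducing `𝔭` has a norm-one
coefficient): an `ι′` inducing `𝔭` exists (`SchneiderFree.exists_branchInducesPrime`) and a frame exists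
(conjunct (i) of `twinSplit_instance_of_goodOrd_of_yanZhu`), so the previous theorem applies.
CONDITIONAL on the named fact `h57`. [cite: YanZhu2024MainConjNonCM, Thm. 5.7 (1) (§5.2; J. Algebra 693 (2026))] -/
theorem twinAlgMu_of_goodOrd_of_yanZhu_of_forall_mu
    (h57 : YanZhu2026.thm57_isTorsion_charIdealXGr_eq_bdpLFunction)
    (W' : WeierstrassCurve ℚ) [W'.IsElliptic] [W'.IsGloballyMinimal] (N' : ℕ) [NeZero N']
    (K : Type) [Field K] [NumberField K] (Dt' : ModularParametrizationData W' N')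
    (hord : GoodOrd W' 3) (hsurj : W'.HasSurjectiveModNGaloisRep 3)
    (hK : IsImaginaryQuadratic K) (hH : SatisfiesHeegnerHypothesis N' K)
    (hodd : Odd (NumberField.discr K))
    (κ : ZpExtension K 3) (hκ : κ.IsAnticyclotomic) (γ : absoluteGaloisGroup K)
    [Fact (κ.IsTopGenerator γ)]
    (𝔭 : HeightOneSpectrum (𝓞 K)) (h𝔭 : ((3 : ℕ) : 𝓞 K) ∈ 𝔭.asIdeal)
    (he : 𝔭.asIdeal.ramificationIdx (𝓞 ℚ) = 1) (hf : 𝔭.asIdeal.inertiaDeg (𝓞 ℚ) = 1)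
    (𝔭' : HeightOneSpectrum (𝓞 K)) (h𝔭' : ((3 : ℕ) : 𝓞 K) ∈ 𝔭'.asIdeal) (hne : 𝔭' ≠ 𝔭)
    (hμ : ∀ ι' : PadicAlgCl 3 ≃+* ℂ, BranchInducesPrime 3 ι' 𝔭 →
      ∀ (ΩK : ℂ) (Ωp : ℂ_[3]) (L' : UnrSeries 3), ΩK ≠ 0 → Ωp ≠ 0 →
        IsBDPLFunction ι' 𝔭 κ γ Dt'.f ΩK Ωp L' →
        ∃ i : ℕ, ‖((PowerSeries.coeff i L' : unrIntegers 3) : ℂ_[3])‖ = 1) :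
    Module.IsTorsion (IwasawaAlgebra 3) (AcSelmer.XAc (W'.baseChange K) 3 κ 𝔭' ∅ γ) ∧
      ∃ g' : UnrSeries 3,
        (AcSelmer.XAc.charIdeal (W'.baseChange K) 3 κ 𝔭' ∅ γ).map (PowerSeries.map (toUnr 3)) =
          Ideal.span {g'} ∧
        ∃ i : ℕ, ‖((PowerSeries.coeff i g' : unrIntegers 3) : ℂ_[3])‖ = 1 := by
  obtain ⟨ι', hι'⟩ := exists_branchInducesPrime 3 hK h𝔭
  obtain ⟨⟨ΩK, Ωp, L', hΩK, hΩp, hL'⟩, -⟩ := ThreeAdicImageOverK.twinSplit_instance_of_goodOrd_of_yanZhu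
    h57 W' N' K Dt' hord hsurj hK hH hodd κ hκ γ 𝔭 h𝔭 he hf 𝔭' h𝔭' hne ι' hι'
  exact twinAlgMu_of_goodOrd_of_yanZhu_of_muFrame h57 W' N' K Dt' hord hsurj hK hH hodd κ hκ γ 𝔭 h𝔭 he hf
    𝔭' h𝔭' hne ⟨ι', hι', ΩK, Ωp, L', hΩK, hΩp, hL', hμ ι' hι' ΩK Ωp L' hΩK hΩp hL'⟩

/-- **Bucket A of `TwinAlgMuZeroAtThree` from BCS 2025 ALONE** (Thm 4.2.1 (b): `X_ac` torsion and
`(L′) ⊆ Ch·R₀⟦T⟧` at every frame; Prop 4.2.2: a frame `L₃` with a unit coefficient) — no Yan–Zhu, no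
main-conjecture equality: `Ch_Λ(X_ac)` is principal (`charIdeal_isPrincipal_holds`), so `Ch·R₀⟦T⟧ = (g)`
with `g ∣ L₃`, and a divisor of a `μ = 0` series has `μ = 0` (§1). CONDITIONAL on the named facts `h421`,
`h422`. [cite: BurungaleCastellaSkinner2025, Thm. 4.2.1 (b) and Prop. 4.2.2 (§4.2, pp. 8–9 of arXiv:2405.00270v2)]
[cite: Washington1997, §13.2 (characteristic ideals of Λ-modules are principal)] -/
theorem twinAlgMu_of_goodOrd_of_bcs
    (h421 : BurungaleCastellaSkinner2025.thm421b_exists_isBDPLFunction_isTorsion_mem_charIdeal)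
    (h422 : BurungaleCastellaSkinner2025.prop422_exists_isBDPLFunction_mu_eq_zero)
    (W' : WeierstrassCurve ℚ) [W'.IsElliptic] [W'.IsGloballyMinimal] (N' : ℕ) [NeZero N']
    (K : Type) [Field K] [NumberField K] (Dt' : ModularParametrizationData W' N')
    (hord : GoodOrd W' 3) (hsurj : W'.HasSurjectiveModNGaloisRep 3)
    (hK : IsImaginaryQuadratic K) (hH : SatisfiesHeegnerHypothesis N' K)
    (hodd : Odd (NumberField.discr K))
    (κ : ZpExtension K 3) (hκ : κ.IsAnticyclotomic) (γ : absoluteGaloisGroup K)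
    [Fact (κ.IsTopGenerator γ)]
    (𝔭 : HeightOneSpectrum (𝓞 K)) (h𝔭 : ((3 : ℕ) : 𝓞 K) ∈ 𝔭.asIdeal)
    (he : 𝔭.asIdeal.ramificationIdx (𝓞 ℚ) = 1) (hf : 𝔭.asIdeal.inertiaDeg (𝓞 ℚ) = 1)
    (𝔭' : HeightOneSpectrum (𝓞 K)) (h𝔭' : ((3 : ℕ) : 𝓞 K) ∈ 𝔭'.asIdeal) (hne : 𝔭' ≠ 𝔭) :
    Module.IsTorsion (IwasawaAlgebra 3) (AcSelmer.XAc (W'.baseChange K) 3 κ 𝔭' ∅ γ) ∧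
      ∃ g' : UnrSeries 3,
        (AcSelmer.XAc.charIdeal (W'.baseChange K) 3 κ 𝔭' ∅ γ).map (PowerSeries.map (toUnr 3)) =
          Ideal.span {g'} ∧
        ∃ i : ℕ, ‖((PowerSeries.coeff i g' : unrIntegers 3) : ℂ_[3])‖ = 1 := by
  obtain ⟨ι', hι'⟩ := exists_branchInducesPrime 3 hK h𝔭
  have hd3 : NumberField.discr K ≠ -3 := discr_ne_neg_three_of_degreeOne hK h𝔭 he hf
  refine ⟨xac_isTorsion_of_goodOrd h421 W' N' K Dt' hord hsurj hK hH hodd κ hκ γ 𝔭 h𝔭 he hf 𝔭' h𝔭'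
    hne ι' hι', ?_⟩
  -- `Ch_Λ(X_ac)` is principal, so its extension to `R₀⟦T⟧` is generated by the image of a generator
  obtain ⟨F, hF⟩ :=
    (charIdeal_isPrincipal_holds 3 (AcSelmer.XAc (W'.baseChange K) 3 κ 𝔭' ∅ γ)).principal
  have hchar : AcSelmer.XAc.charIdeal (W'.baseChange K) 3 κ 𝔭' ∅ γ = Ideal.span {F} := hF
  refine ⟨PowerSeries.map (toUnr 3) F, by rw [hchar, map_span_singleton_eq], ?_⟩
  -- the `μ = 0` frame of Prop 4.2.2
  obtain ⟨ΩK₃, Ωp₃, L₃, hΩK₃, hL₃, hμ⟩ := exists_frame_mu_eq_zero_of_good h422 W' N' K Dt' hord.1 hsurj hK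
    hH hodd hd3 κ hκ γ 𝔭 h𝔭 he hf ι' hι'
  have hΩp₃ : ((Ωp₃ : unrIntegers 3) : ℂ_[3]) ≠ 0 := by
    intro h0
    have h1 := norm_coe_units_unrIntegers 3 Ωp₃
    rw [h0, norm_zero] at h1
    exact zero_ne_one h1
  -- `⊇` at that frame (Thm 4.2.1 (b) moved across periods): the generator divides `L₃`
  have hsup : Ideal.span {L₃} ≤
      (AcSelmer.XAc.charIdeal (W'.baseChange K) 3 κ 𝔭' ∅ γ).map (PowerSeries.map (toUnr 3)) :=
    forall_frame_supset_of_goodOrd h421 W' N' K Dt' hord hsurj hK hH hodd κ hκ γ 𝔭 h𝔭 he hf 𝔭' h𝔭' hne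
      ι' hι' ΩK₃ _ L₃ hΩK₃ hΩp₃ hL₃
  rw [hchar, map_span_singleton_eq, Ideal.span_singleton_le_span_singleton] at hsup
  exact exists_norm_coeff_eq_one_of_dvd hsup (exists_norm_coeff_eq_one_of_exists_isUnit hμ)

/-- **Bucket A of `TwinAlgMuZeroAtThree` from Yan–Zhu 2026 Thm 5.7 (1) and BCS 2025 Prop 4.2.2** (the
`μ = 0` frame of Prop 4.2.2 fed to `twinAlgMu_of_goodOrd_of_yanZhu_of_muFrame`). CONDITIONAL on the named
facts `h57`, `h422`. [cite: YanZhu2024MainConjNonCM, Thm. 5.7 (1) (§5.2; J. Algebra 693 (2026))]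
[cite: BurungaleCastellaSkinner2025, Prop. 4.2.2 (§4.2, pp. 8–9 of arXiv:2405.00270v2)] -/
theorem twinAlgMu_of_goodOrd_of_yanZhu_of_bcsMu
    (h57 : YanZhu2026.thm57_isTorsion_charIdealXGr_eq_bdpLFunction)
    (h422 : BurungaleCastellaSkinner2025.prop422_exists_isBDPLFunction_mu_eq_zero)
    (W' : WeierstrassCurve ℚ) [W'.IsElliptic] [W'.IsGloballyMinimal] (N' : ℕ) [NeZero N']
    (K : Type) [Field K] [NumberField K] (Dt' : ModularParametrizationData W' N')
    (hord : GoodOrd W' 3) (hsurj : W'.HasSurjectiveModNGaloisRep 3)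
    (hK : IsImaginaryQuadratic K) (hH : SatisfiesHeegnerHypothesis N' K)
    (hodd : Odd (NumberField.discr K))
    (κ : ZpExtension K 3) (hκ : κ.IsAnticyclotomic) (γ : absoluteGaloisGroup K)
    [Fact (κ.IsTopGenerator γ)]
    (𝔭 : HeightOneSpectrum (𝓞 K)) (h𝔭 : ((3 : ℕ) : 𝓞 K) ∈ 𝔭.asIdeal)
    (he : 𝔭.asIdeal.ramificationIdx (𝓞 ℚ) = 1) (hf : 𝔭.asIdeal.inertiaDeg (𝓞 ℚ) = 1)
    (𝔭' : HeightOneSpectrum (𝓞 K)) (h𝔭' : ((3 : ℕ) : 𝓞 K) ∈ 𝔭'.asIdeal) (hne : 𝔭' ≠ 𝔭) :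
    Module.IsTorsion (IwasawaAlgebra 3) (AcSelmer.XAc (W'.baseChange K) 3 κ 𝔭' ∅ γ) ∧
      ∃ g' : UnrSeries 3,
        (AcSelmer.XAc.charIdeal (W'.baseChange K) 3 κ 𝔭' ∅ γ).map (PowerSeries.map (toUnr 3)) =
          Ideal.span {g'} ∧
        ∃ i : ℕ, ‖((PowerSeries.coeff i g' : unrIntegers 3) : ℂ_[3])‖ = 1 := by
  obtain ⟨ι', hι'⟩ := exists_branchInducesPrime 3 hK h𝔭
  have hd3 : NumberField.discr K ≠ -3 := discr_ne_neg_three_of_degreeOne hK h𝔭 he hf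
  obtain ⟨ΩK₃, Ωp₃, L₃, hΩK₃, hL₃, hμ⟩ := exists_frame_mu_eq_zero_of_good h422 W' N' K Dt' hord.1 hsurj hK
    hH hodd hd3 κ hκ γ 𝔭 h𝔭 he hf ι' hι'
  have hΩp₃ : ((Ωp₃ : unrIntegers 3) : ℂ_[3]) ≠ 0 := by
    intro h0
    have h1 := norm_coe_units_unrIntegers 3 Ωp₃
    rw [h0, norm_zero] at h1
    exact zero_ne_one h1
  exact twinAlgMu_of_goodOrd_of_yanZhu_of_muFrame h57 W' N' K Dt' hord hsurj hK hH hodd κ hκ γ 𝔭 h𝔭 he hf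
    𝔭' h𝔭' hne ⟨ι', hι', ΩK₃, _, L₃, hΩK₃, hΩp₃, hL₃, exists_norm_coeff_eq_one_of_exists_isUnit hμ⟩

end Pointwise

/-! ## §3 Bucket A in the ROUTE's literal currency

The binder list below is the RK-6 v3 text of `TwinAlgMuZeroAtThree` (pen bsd-wall-pss3x g8, sha16
9afd83391bd6ffcb, confirmed by LEAD utd-p1 g19 08:03Z) with `¬ Addv W' 3` replaced by `GoodOrd W' 3` and
`Odd (NumberField.discr K)` inserted after the Heegner hypothesis — the shape of the closed bucket-A child
`TwinSplitIMCAtThreeGoodOrdOfPrint` (20693) of crux #3 without its `ι′` clause. -/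

section Route

/-- **Bucket A of `TwinAlgMuZeroAtThree` ⟸ `BCSHowardDivisibilityInput ∧ BCSMuZeroInput`** (items
20788-shape aliases of BCS 2025 Thm 4.2.1 (b) and Prop 4.2.2; no Yan–Zhu): one `exact` on
`twinAlgMu_of_goodOrd_of_bcs`. [cite: BurungaleCastellaSkinner2025, Thm. 4.2.1 (b) and Prop. 4.2.2 (§4.2, pp. 8–9 of arXiv:2405.00270v2)] -/
theorem twinAlgMuZeroAtThreeGoodOrd_of_bcs (h421 : BCSHowardDivisibilityInput) (h422 : BCSMuZeroInput) :
    ∀ (W' : WeierstrassCurve ℚ) [W'.IsElliptic] [W'.IsGloballyMinimal] (N' : ℕ) [NeZero N'] (K : Type) [Field K] [NumberField K] (Dt' : Literature.NumberTheory.EllipticCurves.ModularForms.ModularParametrizationData W' N'), Literature.NumberTheory.EllipticCurves.Rank1Residual.GoodOrd W' 3 → W'.HasSurjectiveModNGaloisRep 3 → W'.conductorNorm ℤ = N' → Literature.NumberTheory.EllipticCurves.IsImaginaryQuadratic K → Literature.NumberTheory.EllipticCurves.SatisfiesHeegnerHypothesis N' K → Odd (NumberField.discr K) → ∀ (κ :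 Literature.NumberTheory.EllipticCurves.ZpExtension K 3), κ.IsAnticyclotomic → ∀ (γ : Field.absoluteGaloisGroup K) [Fact (κ.IsTopGenerator γ)] (𝔭 : IsDedekindDomain.HeightOneSpectrum (NumberField.RingOfIntegers K)), ((3 : ℕ) : NumberField.RingOfIntegers K) ∈ 𝔭.asIdeal → 𝔭.asIdeal.ramificationIdx (NumberField.RingOfIntegers ℚ) = 1 → 𝔭.asIdeal.inertiaDeg (NumberField.RingOfIntegers ℚ) = 1 → ∀ (𝔭' : IsDedekindDomain.HeightOneSpectrum (NumberField.RingOfIntegers K)), ((3 : ℕ) : NumberField.RingOfIntegers K) ∈ 𝔭'.asIdeal → 𝔭' ≠ 𝔭 → Module.IsTorsion (Literature.NumberTheory.EllipticCurves.IwasawaAlgebra 3) (Summit.BirchSwinnertonDyer.Rank1Residual.X11b.AcSelmer.XAc (W'.baseChange K) 3 κ 𝔭' ∅ γ) ∧ ∃ g' : Literature.NumberTheory.EllipticCurves.UnrSeries 3, (Summit.BirchSwinnertonDyer.Rank1Residual.X11b.AcSelmer.XAc.charIdeal (W'.baseChange K) 3 κ 𝔭' ∅ γ).map (PowerSeries.map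 (Summit.BirchSwinnertonDyer.Rank1Residual.X11b.Halves.toUnr 3)) = Ideal.span {g'} ∧ ∃ i : ℕ, ‖((PowerSeries.coeff i g' : Literature.NumberTheory.EllipticCurves.unrIntegers 3) : ℂ_[3])‖ = 1 := by
  intro W' _ _ N' _ K _ _ Dt' hord hsurj _hN hK hH hodd κ hκ γ _ 𝔭 h𝔭 he hf 𝔭' h𝔭' hne
  exact twinAlgMu_of_goodOrd_of_bcs h421 h422 W' N' K Dt' hord hsurj hK hH hodd κ hκ γ 𝔭 h𝔭 he hf 𝔭' h𝔭'
    hne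

/-- **Bucket A of `TwinAlgMuZeroAtThree` ⟸ the bucket-A print package `TwinSplitIMCAtThreePrintedFacts`
(item 20692)** — its first and third conjuncts suffice. [cite: BurungaleCastellaSkinner2025, Thm. 4.2.1 (b) and Prop. 4.2.2 (§4.2, pp. 8–9 of arXiv:2405.00270v2)] -/
theorem twinAlgMuZeroAtThreeGoodOrd_of_printedFacts (h : TwinSplitIMCAtThreePrintedFacts) :
    ∀ (W' : WeierstrassCurve ℚ) [W'.IsElliptic] [W'.IsGloballyMinimal] (N' : ℕ) [NeZero N'] (K : Type) [Field K] [NumberField K] (Dt' : Literature.NumberTheory.EllipticCurves.ModularForms.ModularParametrizationData W' N'), Literature.NumberTheory.EllipticCurves.Rank1Residual.GoodOrd W' 3 → W'.HasSurjectiveModNGaloisRep 3 → W'.conductorNorm ℤ = N' → Literature.NumberTheory.EllipticCurves.IsImaginaryQuadratic K → Literature.NumberTheory.EllipticCurves.SatisfiesHeegnerHypothesis N' K → Odd (NumberField.discr K) → ∀ (κ : Literature.NumberTheory.EllipticCurves.ZpExtension K 3), κ.IsAnticyclotomic → ∀ (γ : Field.absoluteGaloisGroup K) [Fact (κ.IsTopGenerator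 γ)] (𝔭 : IsDedekindDomain.HeightOneSpectrum (NumberField.RingOfIntegers K)), ((3 : ℕ) : NumberField.RingOfIntegers K) ∈ 𝔭.asIdeal → 𝔭.asIdeal.ramificationIdx (NumberField.RingOfIntegers ℚ) = 1 → 𝔭.asIdeal.inertiaDeg (NumberField.RingOfIntegers ℚ) = 1 → ∀ (𝔭' : IsDedekindDomain.HeightOneSpectrum (NumberField.RingOfIntegers K)), ((3 : ℕ) : NumberField.RingOfIntegers K) ∈ 𝔭'.asIdeal → 𝔭' ≠ 𝔭 → Module.IsTorsion (Literature.NumberTheory.EllipticCurves.IwasawaAlgebra 3) (Summit.BirchSwinnertonDyer.Rank1Residual.X11b.AcSelmer.XAc (W'.baseChange K) 3 κ 𝔭' ∅ γ) ∧ ∃ g' : Literature.NumberTheory.EllipticCurves.UnrSeries 3, (Summit.BirchSwinnertonDyer.Rank1Residual.X11b.AcSelmer.XAc.charIdeal (W'.baseChange K) 3 κ 𝔭' ∅ γ).map (PowerSeries.map (Summit.BirchSwinnertonDyer.Rank1Residual.X11b.Halves.toUnr 3)) = Ideal.span {g'} ∧ ∃ i : ℕ, ‖((PowerSeries.coeff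 i g' : Literature.NumberTheory.EllipticCurves.unrIntegers 3) : ℂ_[3])‖ = 1 :=
  twinAlgMuZeroAtThreeGoodOrd_of_bcs h.1 h.2.2

/-- **Bucket A of `TwinAlgMuZeroAtThree` ⟸ `YanZhuMainConjectureInput ∧ BCSMuZeroInput`** (the kernel's
twin package fact + Prop 4.2.2). [cite: YanZhu2024MainConjNonCM, Thm. 5.7 (1) (§5.2; J. Algebra 693 (2026))]
[cite: BurungaleCastellaSkinner2025, Prop. 4.2.2 (§4.2, pp. 8–9 of arXiv:2405.00270v2)] -/
theorem twinAlgMuZeroAtThreeGoodOrd_of_yanZhu_of_bcsMu (h57 : YanZhuMainConjectureInput)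
    (h422 : BCSMuZeroInput) :
    ∀ (W' : WeierstrassCurve ℚ) [W'.IsElliptic] [W'.IsGloballyMinimal] (N' : ℕ) [NeZero N'] (K : Type) [Field K] [NumberField K] (Dt' : Literature.NumberTheory.EllipticCurves.ModularForms.ModularParametrizationData W' N'), Literature.NumberTheory.EllipticCurves.Rank1Residual.GoodOrd W' 3 → W'.HasSurjectiveModNGaloisRep 3 → W'.conductorNorm ℤ = N' → Literature.NumberTheory.EllipticCurves.IsImaginaryQuadratic K → Literature.NumberTheory.EllipticCurves.SatisfiesHeegnerHypothesis N' K → Odd (NumberField.discr K) → ∀ (κ : Literature.NumberTheory.EllipticCurves.ZpExtension K 3), κ.IsAnticyclotomic → ∀ (γ : Field.absoluteGaloisGroup K) [Fact (κ.IsTopGenerator γ)] (𝔭 : IsDedekindDomain.HeightOneSpectrum (NumberField.RingOfIntegers K)), ((3 : ℕ) : NumberField.RingOfIntegers K) ∈ 𝔭.asIdeal → 𝔭.asIdeal.ramificationIdx (NumberField.RingOfIntegers ℚ) = 1 → 𝔭.asIdeal.inertiaDeg (NumberField.RingOfIntegers ℚ) = 1 → ∀ (𝔭' : IsDedekindDomain.HeightOneSpectrum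 (NumberField.RingOfIntegers K)), ((3 : ℕ) : NumberField.RingOfIntegers K) ∈ 𝔭'.asIdeal → 𝔭' ≠ 𝔭 → Module.IsTorsion (Literature.NumberTheory.EllipticCurves.IwasawaAlgebra 3) (Summit.BirchSwinnertonDyer.Rank1Residual.X11b.AcSelmer.XAc (W'.baseChange K) 3 κ 𝔭' ∅ γ) ∧ ∃ g' : Literature.NumberTheory.EllipticCurves.UnrSeries 3, (Summit.BirchSwinnertonDyer.Rank1Residual.X11b.AcSelmer.XAc.charIdeal (W'.baseChange K) 3 κ 𝔭' ∅ γ).map (PowerSeries.map (Summit.BirchSwinnertonDyer.Rank1Residual.X11b.Halves.toUnr 3)) = Ideal.span {g'} ∧ ∃ i : ℕ, ‖((PowerSeries.coeff i g' : Literature.NumberTheory.EllipticCurves.unrIntegers 3) : ℂ_[3])‖ = 1 := by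
  intro W' _ _ N' _ K _ _ Dt' hord hsurj _hN hK hH hodd κ hκ γ _ 𝔭 h𝔭 he hf 𝔭' h𝔭' hne
  exact twinAlgMu_of_goodOrd_of_yanZhu_of_bcsMu h57 h422 W' N' K Dt' hord hsurj hK hH hodd κ hκ γ 𝔭 h𝔭
    he hf 𝔭' h𝔭' hne

end Route

/-! ## §4 Bucket A in the KERNEL's context: Yan–Zhu + the route item `TwinMuZeroAtThree` by name -/

section Kernel

/-- **The good-ordinary third of kernel_rat⁺'s twin trichotomy needs no `TwinAlgMuZeroAtThree`
antecedent.** In the kernel's context — a wild curve `W` of class O6 at `3` with `ρ̄_{W,3}` onto and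
analytic rank one, its `3`-congruent twin `W′` GOOD ORDINARY at `3`, a Heegner field `K` for both
conductors with `3` split and `d_K` odd — the conclusion of `TwinAlgMuZeroAtThree` at the twin instance
follows from `YanZhuMainConjectureInput` (kernel binder inside `ToricPrintedLeavesAtThree`) and the route
item `TwinMuZeroAtThree` (20400, kernel binder) BY NAME: the latter supplies the `∀ ι′ ∀ frame` analytic
`μ = 0` consumed by `twinAlgMu_of_goodOrd_of_yanZhu_of_forall_mu`. CONDITIONAL on `h57`; `hmu` is a
route item taken as a hypothesis. [cite: YanZhu2024MainConjNonCM, Thm. 5.7 (1) (§5.2; J. Algebra 693 (2026))] -/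
theorem twinAlgMu_of_goodOrd_of_yanZhu_of_twinMuZero (h57 : YanZhuMainConjectureInput)
    (hmu : TwinMuZeroAtThree)
    (W : WeierstrassCurve ℚ) [W.IsElliptic] [W.IsGloballyMinimal]
    (W' : WeierstrassCurve ℚ) [W'.IsElliptic] [W'.IsGloballyMinimal] (N N' : ℕ) [NeZero N] [NeZero N']
    (K : Type) [Field K] [NumberField K] (Dt : ModularParametrizationData W N)
    (Dt' : ModularParametrizationData W' N')
    (hO6 : Additive.ClassO6 W 3) (hsurj : W.HasSurjectiveModNGaloisRep 3) (hr : W.analyticRank = 1)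
    (hN : W.conductorNorm ℤ = N) (hcong : O6.ModPCongruent W' W 3)
    (hord : GoodOrd W' 3) (hsurj' : W'.HasSurjectiveModNGaloisRep 3) (hN' : W'.conductorNorm ℤ = N')
    (hK : IsImaginaryQuadratic K) (hH : SatisfiesHeegnerHypothesis N K)
    (hH' : SatisfiesHeegnerHypothesis N' K) (hodd : Odd (NumberField.discr K))
    (κ : ZpExtension K 3) (hκ : κ.IsAnticyclotomic) (γ : absoluteGaloisGroup K)
    [Fact (κ.IsTopGenerator γ)]
    (𝔭 : HeightOneSpectrum (𝓞 K)) (h𝔭 : ((3 : ℕ) : 𝓞 K) ∈ 𝔭.asIdeal)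
    (he : 𝔭.asIdeal.ramificationIdx (𝓞 ℚ) = 1) (hf : 𝔭.asIdeal.inertiaDeg (𝓞 ℚ) = 1)
    (𝔭' : HeightOneSpectrum (𝓞 K)) (h𝔭' : ((3 : ℕ) : 𝓞 K) ∈ 𝔭'.asIdeal) (hne : 𝔭' ≠ 𝔭) :
    Module.IsTorsion (IwasawaAlgebra 3) (AcSelmer.XAc (W'.baseChange K) 3 κ 𝔭' ∅ γ) ∧
      ∃ g' : UnrSeries 3,
        (AcSelmer.XAc.charIdeal (W'.baseChange K) 3 κ 𝔭' ∅ γ).map (PowerSeries.map (toUnr 3)) =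
          Ideal.span {g'} ∧
        ∃ i : ℕ, ‖((PowerSeries.coeff i g' : unrIntegers 3) : ℂ_[3])‖ = 1 :=
  have hnA : ¬ Addv W' 3 := fun h ↦ h.1 hord.1
  twinAlgMu_of_goodOrd_of_yanZhu_of_forall_mu h57 W' N' K Dt' hord hsurj' hK hH' hodd κ hκ γ 𝔭 h𝔭 he hf 𝔭'
    h𝔭' hne (fun ι' hι' ΩK Ωp L' hΩK hΩp hL' ↦ hmu W W' N N' K Dt Dt' hO6 hsurj hr hN hcong hnA hN' hK hH
      hH' κ hκ γ 𝔭 h𝔭 he hf 𝔭' h𝔭' hne ι' hι' ΩK Ωp L' hΩK hΩp hL')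

end Kernel

end Summit.BirchSwinnertonDyer.BirchSwinnertonDyer.Theorems.UniversalToricDescentTwinAlgMu

end
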